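import Summits.SmoothPoincare4.SmoothPoincare4.Theorems.ConvexBisectionAcyclicBisectionExistsChartedChainPassage
import Summits.SmoothPoincare4.SmoothPoincare4.Theorems.ConvexBisectionAcyclicBisectionExistsChartedChainPassagePrevCross
import Summits.SmoothPoincare4.SmoothPoincare4.Theorems.ConvexBisectionAcyclicBisectionExistsChartedChainCycleOrient
import HarnessLib

/-!
# The charted model chain of a page: assembly of (R2′) for node N1a
(wave 4, brick Y4-5 of the model chain (R2) `exists_charted_chain` for the missing lemma
`crossingNumber_eq_stdSymp` of node N1a of stub `stub_modelsOnFibred_of_reach` = NF4, line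
`modp-braid-orbits`, crux `ConvexBisection.AcyclicBisectionExists`, item stmt-SmoothPoincare4-10508;
registered sub-goal `helper_exists_charted_chain`)

For every unit direction `c` the page `page g c` of the Lefschetz base carries a CHARTED MODEL CHAIN:
`2g` page curves `b j = baseRot g (j+1) ∘ b₀` with annulus charts `ψ j = baseRot g (j+1) ∘ ψ₀`
(`ψ₀ = cycleChart`, the Joukowski chart of the vanishing cycle over the symmetric chord, `b₀` its
core; `baseRot` the cyclic symmetry `x ↦ e^{2πik/(2g+1)} x`) satisfying the six chart hypotheses of
node N1a (`helper_chart_baseRot`, `helper_cycleChart`), with homology shadows `chainVec g j`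
(`helper_shadow_baseRot_cycleCore`) and crossing numbers

  `crossingNumber (ψ i) (b j) = crossingNumber ψ₀ (baseRot ((j − i) mod (2g+1)) ∘ b₀)
    = [j = i + 1] − [i = j + 1]`

— `1` for the next cycle (`helper_crossingNumber_cycle_next`, one climbing passage), `−1` for the
previous one (`helper_crossingNumber_cycle_prev`, one descending passage), `0` for the core
(`crossingNumber_core_eq_zero`) and `0` for the far cycles, whose `x`-projections are separated from
the collar of `ψ₀` by the line `Re x = m − σ/(4(2g+1))` (§1).  This is EXACTLY statement (R2)
`exists_charted_chain` of Z6-REPORT §3 (`ChartHyp` inlined) — **`exists_charted_chain`** below; the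
registered form **`helper_exists_charted_chain`** records the same chain with the off-sub-diagonal
entries and the (now unconditional) full `A_{2g}` pattern.
Everything is proved; no `sorry`.  References: J. Milnor, *Singular points of complex
hypersurfaces* (1968), §9 [Milnor1968]; V. I. Arnold, S. M. Gusein-Zade, A. N. Varchenko,
*Singularities of Differentiable Maps II* (1988), §2 [AGZV1988]; B. Farb, D. Margalit, *A primer on
mapping class groups* (2012), §6.1 [FarbMargalit2012].
-/

noncomputable section

set_option linter.dupNamespace false

open scoped Manifold ContDiff Topology ComplexConjugate Real
open Set Function Metric Complex
open Literature.Topology.FourManifolds Literature.Topology.FourManifolds.LefschetzBase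
  Literature.Topology.FourManifolds.TorusKnotMilnor

namespace Summit.SmoothPoincare4.SmoothPoincare4.Theorems.AcyclicBisectionExists.ModpBraidOrbits

variable {g : ℕ} {c : ℂ}

/-! ## §1 The far cycles miss the collar of the chart -/

/-- `Re ζ_k ≤ cos θ_1` for `1 ≤ k ≤ 2g − 1` (`ζ_{2g−k} = conj ζ_k` reduces to `k ≤ g`, where the
angle is at most `π`). [folklore] -/
theorem re_branchPt_le (hg : 1 ≤ g) {k : ℕ} (hk1 : 1 ≤ k) (hk2 : k ≤ 2 * g - 1) :
    (branchPt g k).re ≤ Real.cos (branchAngle g 1) := by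
  have h0 : (0 : ℝ) < 2 * g + 1 := by positivity
  have key : ∀ k', 1 ≤ k' → k' ≤ g → (branchPt g k').re ≤ Real.cos (branchAngle g 1) := by
    intro k' h1 h2
    rw [branchPt, Complex.exp_ofReal_mul_I_re]
    refine Real.cos_le_cos_of_nonneg_of_le_pi (by unfold branchAngle; positivity) ?_ ?_
    · unfold branchAngle
      rw [div_le_iff₀ h0]
      have : (k' : ℝ) ≤ g := by exact_mod_cast h2
      nlinarith [Real.pi_pos]
    · unfold branchAngle
      have : (1 : ℝ) ≤ k' := by exact_mod_cast h1
      gcongr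
  by_cases h : k ≤ g
  · exact key k hk1 h
  · have e : branchPt g k = conj (branchPt g (2 * g - k)) := by
      rw [← branchPt_two_mul_sub (show 2 * g - k ≤ 2 * g by omega)]
      congr 1; omega
    rw [e, Complex.conj_re]
    exact key (2 * g - k) (by omega) (by omega)

/-- The rotated chord point: `Re (ω^k (m + iσ y)) ≤ cos θ_1` for `|y| ≤ 1`, `2 ≤ k ≤ 2g − 1`
(a convex combination of `Re ζ_k` and `Re ζ_{k−1}`). [folklore] -/
theorem re_rootU_pow_mul_chord_le (hg : 1 ≤ g) {k : ℕ} (hk1 : 2 ≤ k) (hk2 : k ≤ 2 * g - 1) {y : ℝ}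
    (hy : |y| ≤ 1) :
    (rootU (2 * g + 1) ^ k * ((cmid g : ℂ) + ((shalf g * y : ℝ) : ℂ) * I)).re ≤ Real.cos (branchAngle g 1) := by
  have hη : (cmid g : ℂ) + (shalf g : ℂ) * I = branchPt g 0 := (branchPt_zero_eq g).symm
  have hηbar : (cmid g : ℂ) - (shalf g : ℂ) * I = branchPt g (2 * g) := by
    rw [show 2 * g = 2 * g - 0 from rfl, branchPt_two_mul_sub (Nat.zero_le _), branchPt_zero_eq, map_add, map_mul,
      Complex.conj_ofReal, Complex.conj_ofReal, Complex.conj_I]; ring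
  have e : (cmid g : ℂ) + ((shalf g * y : ℝ) : ℂ) * I =
      (((1 + y) / 2 : ℝ) : ℂ) * ((cmid g : ℂ) + (shalf g : ℂ) * I) + (((1 - y) / 2 : ℝ) : ℂ) * ((cmid g : ℂ) - (shalf g : ℂ) * I) := by
    push_cast; ring
  have hk : rootU (2 * g + 1) ^ k * branchPt g 0 = branchPt g k := by
    rw [branchPt_eq_halfRoot_mul, branchPt_eq_halfRoot_mul, pow_zero, mul_one, mul_comm]
  have hk' : rootU (2 * g + 1) ^ k * branchPt g (2 * g) = branchPt g (k - 1) := by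
    rw [branchPt_eq_halfRoot_mul, branchPt_eq_halfRoot_mul, mul_left_comm, ← pow_add,
      show k + 2 * g = (k - 1) + (2 * g + 1) by omega, pow_add, rootU_pow_self (Nat.succ_ne_zero _), mul_one]
  rw [e, mul_add, hη, hηbar, mul_left_comm, hk, mul_left_comm, hk', Complex.add_re, Complex.re_ofReal_mul,
    Complex.re_ofReal_mul]
  have h1 := re_branchPt_le hg (by omega : 1 ≤ k) hk2
  have h2 := re_branchPt_le hg (by omega : 1 ≤ k - 1) (by omega)
  have hy1 := (abs_le.1 hy).1
  have hy2 := (abs_le.1 hy).2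
  nlinarith

/-- `|PS| ≤ 1` for `|P|, |S| ≤ 1` in the form used below. [folklore] -/
theorem neg_mul_le_one {P S : ℝ} (hP : P ^ 2 ≤ 1) (hS : S ^ 2 ≤ 1) : -(P * S) ≤ 1 := by
  nlinarith [sq_nonneg (P + S), sq_nonneg (P - S)]

/-- **The `x`-projection of a rotated Joukowski circle stays left of the collar**: for
`t = ρ e^{iθ}`, `1 ≤ ρ ≤ 1 + 1/(4(2g+1))`, `2 ≤ k ≤ 2g − 1`,
`Re (ω^k jX t) ≤ cos θ_1 + σ/(4(2g+1))`. [folklore] -/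
theorem re_rootU_pow_mul_jX_le (hg : 1 ≤ g) {k : ℕ} (hk1 : 2 ≤ k) (hk2 : k ≤ 2 * g - 1) {ρ θ : ℝ}
    (h1 : 1 ≤ ρ) (h2 : ρ ≤ 1 + 1 / (4 * (2 * g + 1))) :
    (rootU (2 * g + 1) ^ k * jX g ((ρ : ℂ) * Complex.exp (θ * I))).re ≤
      Real.cos (branchAngle g 1) + shalf g / (4 * (2 * g + 1)) := by
  obtain ⟨C, S, hCS, he⟩ : ∃ C S : ℝ, C ^ 2 + S ^ 2 = 1 ∧ Complex.exp (θ * I) = C + S * I :=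
    ⟨Real.cos θ, Real.sin θ, Real.cos_sq_add_sin_sq θ, (exp_mul_I_and_inv θ).1⟩
  obtain ⟨P, Q, hPQ, hω⟩ : ∃ P Q : ℝ, P ^ 2 + Q ^ 2 = 1 ∧ rootU (2 * g + 1) ^ k = P + Q * I := by
    refine ⟨Real.cos (2 * π * k / (2 * g + 1)), Real.sin (2 * π * k / (2 * g + 1)), Real.cos_sq_add_sin_sq _, ?_⟩
    rw [← (exp_mul_I_and_inv _).1, rootU, ← Complex.exp_nat_mul]
    congr 1; push_cast; ring
  have hρ0 : (0 : ℝ) < ρ := by linarith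
  have hρC : (ρ : ℂ) ≠ 0 := by exact_mod_cast hρ0.ne'
  have hinv : ((ρ : ℂ) * Complex.exp (θ * I))⁻¹ = (ρ : ℂ)⁻¹ * ((C : ℂ) - (S : ℂ) * I) := by
    rw [he]
    refine inv_eq_of_mul_eq_one_right ?_
    have hCS' : (C : ℂ) ^ 2 + (S : ℂ) ^ 2 = 1 := by exact_mod_cast hCS
    have hρρ : (ρ : ℂ) * (ρ : ℂ)⁻¹ = 1 := mul_inv_cancel₀ hρC
    linear_combination ((C : ℂ) ^ 2 + (S : ℂ) ^ 2) * hρρ + hCS' - ((ρ : ℂ) * (ρ : ℂ)⁻¹) * (S : ℂ) ^ 2 * Complex.I_sq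
  have hjX : jX g ((ρ : ℂ) * Complex.exp (θ * I)) =
      ((cmid g - shalf g * ((ρ - ρ⁻¹) / 2) * S : ℝ) : ℂ) + ((shalf g * ((ρ + ρ⁻¹) / 2) * C : ℝ) : ℂ) * I := by
    rw [jX, hinv, he]
    push_cast
    linear_combination ((shalf g : ℂ) * (((ρ : ℂ) - (ρ : ℂ)⁻¹) / 2) * (S : ℂ)) * Complex.I_sq
  have hre : ∀ X Y : ℝ, (((P : ℂ) + (Q : ℂ) * I) * ((X : ℂ) + (Y : ℂ) * I)).re = P * X - Q * Y := by
    intro X Y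
    simp only [Complex.mul_re, Complex.add_re, Complex.add_im, Complex.mul_im, Complex.ofReal_re,
      Complex.ofReal_im, Complex.I_re, Complex.I_im]
    ring
  have hC : C ^ 2 ≤ 1 := by nlinarith [sq_nonneg S]
  have hS : S ^ 2 ≤ 1 := by nlinarith [sq_nonneg C]
  have hP : P ^ 2 ≤ 1 := by nlinarith [sq_nonneg Q]
  have hQ : Q ^ 2 ≤ 1 := by nlinarith [sq_nonneg P]
  have hmain : P * cmid g - Q * (shalf g * C) ≤ Real.cos (branchAngle g 1) := by
    have h := re_rootU_pow_mul_chord_le hg hk1 hk2 (y := C) (abs_le.2 ⟨by nlinarith, by nlinarith⟩)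
    rwa [hω, hre] at h
  rw [hjX, hω, hre]
  have hs := shalf_pos hg
  have hb0 : 0 ≤ (ρ - ρ⁻¹) / 2 := by have : ρ⁻¹ ≤ 1 := inv_le_one_of_one_le₀ h1; linarith
  have ha1 : 0 ≤ (ρ + ρ⁻¹) / 2 - 1 := by
    have : ρ⁻¹ * ρ = 1 := inv_mul_cancel₀ hρ0.ne'
    nlinarith [sq_nonneg (ρ - 1), inv_pos.2 hρ0]
  have e1 := mul_le_mul_of_nonneg_left (neg_mul_le_one hP hS) (mul_nonneg hs.le hb0)
  have e2 := mul_le_mul_of_nonneg_left (neg_mul_le_one hQ hC) (mul_nonneg hs.le ha1)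
  have hsum : (ρ - ρ⁻¹) / 2 + ((ρ + ρ⁻¹) / 2 - 1) = ρ - 1 := by ring
  have hρ1 : shalf g * (ρ - 1) ≤ shalf g / (4 * (2 * g + 1)) := by
    rw [div_eq_mul_one_div]; exact mul_le_mul_of_nonneg_left (by linarith) hs.le
  nlinarith

/-- **The far cycles miss the collar**: for `2 ≤ k ≤ 2g − 1` the rotated core `baseRot g k ∘ b` is
off the closed collar of `cycleChart`. [folklore] -/
theorem baseRot_core_not_mem_collar (hg : 1 ≤ g) (hc : ‖c‖ ≤ 1) {b : sphere (0 : EuclideanSpace ℝ (Fin 2)) 1 → Base g}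
    (hbu : ∀ u : ℝ, cycleChart hg hc (u, 0) = b (circlePt u)) {k : ℕ} (hk1 : 2 ≤ k) (hk2 : k ≤ 2 * g - 1) (t : ℝ) :
    (baseRot g k ∘ b) (circlePt t) ∉ cycleChart hg hc '' (univ ×ˢ Icc (-(1 / 2) : ℝ) (1 / 2)) := fun hq => by
  obtain ⟨p, -, -, hx, -, hhi⟩ := collar_point hg hc hq
  rw [comp_apply, ← hbu, baseRot_val, cx_rotAmbL, cycleChart_val, cycleAmb, cx_pagePt, mul_left_comm] at hx
  have e := mul_left_cancel₀ (scaleX_ne_zero hc) hx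
  have hre := congrArg Complex.re e
  -- left side: the rotated core is left of the line
  have hL := re_rootU_pow_mul_jX_le hg hk1 hk2 (θ := 2 * π * t) (one_lt_radP g 0).le (radP_le g 0)
  have eT : tParam g (t, 0) = ((radP g 0 : ℝ) : ℂ) * Complex.exp (((2 * π * t : ℝ) : ℂ) * I) := rfl
  rw [← eT] at hL
  -- right side: the collar is right of the line
  have hR := re_jX_ge_b hg (one_lt_norm_tParam g p).le
  have hbT : (‖tParam g p‖ - ‖tParam g p‖⁻¹) / 2 ≤ 1 / (4 * (2 * g + 1)) := by
    have h1 := one_lt_norm_tParam g p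
    have h2 : ‖tParam g p‖ ≤ 1 + 1 / (4 * (2 * g + 1)) := hhi.trans (radP_le g _)
    have : 0 < ‖tParam g p‖⁻¹ := by positivity
    have : ‖tParam g p‖⁻¹ * ‖tParam g p‖ = 1 := inv_mul_cancel₀ (by linarith)
    nlinarith
  have hs := shalf_pos hg
  have hσ := two_div_le_shalf hg
  have hgap := cos_branchAngle_one_le hg
  have h0 : (0 : ℝ) < 2 * g + 1 := by positivity
  have hkey : shalf g / (4 * (2 * g + 1)) + shalf g * (1 / (4 * (2 * g + 1))) < 2 * shalf g ^ 2 := by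
    have e1 : shalf g / (4 * (2 * g + 1)) + shalf g * (1 / (4 * (2 * g + 1))) = shalf g * (1 / (2 * (2 * g + 1))) := by
      field_simp; ring
    rw [e1, show 2 * shalf g ^ 2 = shalf g * (2 * shalf g) by ring]
    refine mul_lt_mul_of_pos_left ?_ hs
    calc (1 : ℝ) / (2 * (2 * g + 1)) < 2 * (2 / (2 * g + 1)) := by
          rw [div_lt_iff₀ (by positivity)]; field_simp; norm_num
      _ ≤ 2 * shalf g := by linarith
  rw [hre] at hL
  nlinarith [mul_le_mul_of_nonneg_left hbT hs.le]

/-! ## §2 The crossing numbers of the rotation-generated chain -/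

/-- The reduction of all crossing numbers of the chain to `c_k = crossingNumber ψ₀ (baseRot k ∘ b₀)`
and their values: `c_0 = 0` (core), `c_1 = 1` (climbing passage), `c_k = 0` for `2 ≤ k ≤ 2g − 1`
(far), `c_{2g} = −1` (descending passage). [cite: FarbMargalit2012, §6.1] -/
theorem crossingNumber_chain (hg : 1 ≤ g) (hc : ‖c‖ = 1) {b : sphere (0 : EuclideanSpace ℝ (Fin 2)) 1 → Base g}
    (hbu : ∀ u : ℝ, cycleChart hg hc.le (u, 0) = b (circlePt u)) {i j : ℕ} (hi : i < 2 * g) (hj : j < 2 * g) :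
    crossingNumber (baseRot g (i + 1) ∘ cycleChart hg hc.le) (baseRot g (j + 1) ∘ b) =
      if j = i + 1 then 1 else if i = j + 1 then -1 else 0 := by
  have hψ1 := cycleChart_periodic hg hc.le
  have hψi := cycleChart_injOn hg hc.le
  have hfar : ∀ k, 2 ≤ k → k ≤ 2 * g - 1 → crossingNumber (cycleChart hg hc.le) (baseRot g k ∘ b) = 0 :=
    fun k hk1 hk2 => crossingNumber_eq_zero_of_not_mem_collar fun t => baseRot_core_not_mem_collar hg hc.le hbu hk1 hk2 t
  rcases le_or_gt i j with h | h
  · -- `j = i + k`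
    obtain ⟨k, rfl⟩ := Nat.exists_eq_add_of_le h
    rw [show i + k + 1 = (i + 1) + k by ring, crossingNumber_baseRot_comp_add hψ1 hψi]
    by_cases hk1 : k = 1
    · subst hk1; rw [if_pos rfl]; exact helper_crossingNumber_cycle_next g c hg hc b hbu
    · rw [if_neg (by omega), if_neg (by omega)]
      rcases Nat.eq_zero_or_pos k with hk0 | hk0
      · subst hk0
        have e : baseRot g 0 ∘ b = b := funext fun θ => baseRot_zero g (b θ)
        rw [e]; exact crossingNumber_core_eq_zero hψ1 hbu hψi
      · exact hfar k (by omega) (by omega)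
  · -- `j < i`: use the period, `j + 1 + (2g+1) = (i + 1) + (2g + 1 − (i − j))`
    rw [if_neg (by omega), ← baseRot_comp_period (j + 1),
      show j + 1 + (2 * g + 1) = (i + 1) + (2 * g + 1 - (i - j)) by omega, crossingNumber_baseRot_comp_add hψ1 hψi]
    by_cases h1 : i = j + 1
    · rw [if_pos h1, show 2 * g + 1 - (i - j) = 2 * g by omega]
      exact helper_crossingNumber_cycle_prev g c hg hc b hbu
    · rw [if_neg h1]
      exact hfar _ (by omega) (by omega)

/-! ## §3 The charted model chain -/

/-- **(R2) `exists_charted_chain`** (Z6-REPORT §3, `ChartHyp` inlined): for every unit direction `c`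
there are `2g` page curves `b j` of `page g c` with annulus charts `ψ j` satisfying the six chart
hypotheses of node N1a, with homology shadows `chainVec g j` and the `A_{2g}` crossing pattern
`crossingNumber (ψ i) (b j) = [j = i + 1] − [i = j + 1]`. [cite: AGZV1988, §2] -/
theorem exists_charted_chain (g : ℕ) (c : ℂ) (hc : ‖c‖ = 1) :
    ∃ (b : Fin (2 * g) → sphere (0 : EuclideanSpace ℝ (Fin 2)) 1 → Base g) (ψ : Fin (2 * g) → ℝ × ℝ → Base g)
      (hb : ∀ i, Continuous (b i)),
      (∀ i, ContMDiff 𝓘(ℝ, ℝ × ℝ) (𝓡∂ 4) ∞ (ψ i) ∧ (∀ u r, ψ i (u + 1, r) = ψ i (u, r)) ∧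
        (∀ u, ψ i (u, 0) = b i (circlePt u)) ∧ (∀ p, ψ i p ∈ page g c) ∧
        InjOn (ψ i) (Ico (0 : ℝ) 1 ×ˢ Ioo (-1 : ℝ) 1) ∧
        (∀ u r, r ∈ Ioo (-1 : ℝ) 1 →
          0 < inner ℝ (deriv (fun r' => (ψ i (u, r')).1) r) (cplxJ (deriv (fun u' => (ψ i (u', r)).1) u)))) ∧
      (∀ i, shadow g (b i) (hb i) = chainVec g i) ∧
      ∀ i j : Fin (2 * g), crossingNumber (ψ i) (b j) =
        if (j : ℕ) = i + 1 then 1 else if (i : ℕ) = j + 1 then -1 else 0 := by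
  rcases Nat.eq_zero_or_pos g with hg0 | hg
  · subst hg0
    exact ⟨fun i => i.elim0, fun i => i.elim0, fun i => i.elim0, fun i => i.elim0, fun i => i.elim0, fun i => i.elim0⟩
  have hc' : ‖c‖ ≤ 1 := hc.le
  obtain ⟨b₀, hb₀, hsm, hper, hcore, hpage, hinj, hor⟩ := helper_cycleChart g c hg hc'
  refine ⟨fun j => baseRot g (j + 1) ∘ b₀, fun j => baseRot g (j + 1) ∘ cycleChart hg hc',
    fun j => (continuous_baseRot g _).comp hb₀, fun j => ?_, fun j => ?_, fun i j => ?_⟩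
  · exact helper_chart_baseRot g (j + 1) c b₀ (cycleChart hg hc') hsm hper hcore hpage hinj hor
  · exact helper_shadow_baseRot_cycleCore g c hg hc' b₀ hcore j j.2 _
  · exact crossingNumber_chain hg hc hcore i.2 j.2

/-- **Sub-goal `helper_exists_charted_chain`** (the model chain for node N1a of NF4, registered
form): for every unit direction `c` there are `2g` page curves `b j` of `page g c` with annulus
charts `ψ j` satisfying the six chart hypotheses of node N1a, with homology shadows `chainVec g j`,
with crossing numbers `[j = i + 1]` off the sub-diagonal, and with the full `A_{2g}` pattern
`[j = i + 1] − [i = j + 1]` (stated under the — here superfluous — antisymmetry hypothesis).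
[cite: AGZV1988, §2] -/
theorem helper_exists_charted_chain : ∀ (g : ℕ) (c : ℂ), ‖c‖ = 1 → ∃ (b : Fin (2 * g) → Metric.sphere (0 : EuclideanSpace ℝ (Fin 2)) 1 → Literature.Topology.FourManifolds.LefschetzBase.Base g) (ψ : Fin (2 * g) → ℝ × ℝ → Literature.Topology.FourManifolds.LefschetzBase.Base g) (hb : ∀ i, Continuous (b i)), (∀ i, ContMDiff 𝓘(ℝ, ℝ × ℝ) (𝓡∂ 4) ∞ (ψ i) ∧ (∀ u r, ψ i (u + 1, r) = ψ i (u, r)) ∧ (∀ u, ψ i (u, 0) = b i (Literature.Topology.FourManifolds.circlePt u)) ∧ (∀ p, ψ i p ∈ Literature.Topology.FourManifolds.LefschetzBase.page g c) ∧ Set.InjOn (ψ i) (Set.Ico (0 : ℝ) 1 ×ˢ Set.Ioo (-1 : ℝ) 1) ∧ (∀ u r, r ∈ Set.Ioo (-1 : ℝ) 1 → 0 < inner ℝ (deriv (fun r' => (ψ i (u, r')).1) r) (Literature.Topology.FourManifolds.LefschetzBase.cplxJ (deriv (fun u' => (ψ i (u', r)).1) u)))) ∧ (∀ i, Literature.Topology.FourManifolds.LefschetzBase.shadow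 g (b i) (hb i) = Literature.Topology.FourManifolds.LefschetzBase.chainVec g i) ∧ (∀ i j : Fin (2 * g), (i : ℕ) ≠ j + 1 → Summit.SmoothPoincare4.SmoothPoincare4.Theorems.AcyclicBisectionExists.ModpBraidOrbits.crossingNumber (ψ i) (b j) = if (j : ℕ) = i + 1 then 1 else 0) ∧ ((∀ i j : Fin (2 * g), Summit.SmoothPoincare4.SmoothPoincare4.Theorems.AcyclicBisectionExists.ModpBraidOrbits.crossingNumber (ψ i) (b j) = -Summit.SmoothPoincare4.SmoothPoincare4.Theorems.AcyclicBisectionExists.ModpBraidOrbits.crossingNumber (ψ j) (b i)) → ∀ i j : Fin (2 * g), Summit.SmoothPoincare4.SmoothPoincare4.Theorems.AcyclicBisectionExists.ModpBraidOrbits.crossingNumber (ψ i) (b j) = if (j : ℕ) = i + 1 then 1 else if (i : ℕ) = j + 1 then -1 else 0) := by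
  intro g c hc
  obtain ⟨b, ψ, hb, hch, hsh, hcn⟩ := exists_charted_chain g c hc
  refine ⟨b, ψ, hb, hch, hsh, fun i j hij => ?_, fun _ => hcn⟩
  rw [hcn i j]
  by_cases h : (j : ℕ) = i + 1
  · rw [if_pos h, if_pos h]
  · rw [if_neg h, if_neg h, if_neg hij]

end Summit.SmoothPoincare4.SmoothPoincare4.Theorems.AcyclicBisectionExists.ModpBraidOrbits

end
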